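import Mathlib
import HarnessLib
import Literature.NumberTheory.LFunctions.HorocyclePhase

/-!
# Two integrations by parts against the horocycle phase

Support file (all statements PROVED, no definitions, no named facts) for the elementary proof of
the CONDITIONAL rate of equidistribution of closed horocycles on `SL(2,ℤ)\ℍ`
(`Literature.NumberTheory.LFunctions.horocycleRate_of_quasiRH`, `HorocycleRH.lean`; Zagier 1981
§1 p. 279, Sarnak 1981 Thm. 1), continuing `HorocyclePhase.lean`, whose ONE integration by parts
against the phase `exp(iκX(t))`, `X(t) = -t/(w(1+t²))`, on the branches `|t| ≥ √2` of the
horocycle of diameter `1/w` gives the uniform bound `‖b_k(w)‖ ≤ M/|k|³` for the Fourier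
coefficients of the horocycle integral. The conditional rate needs the `w`-DERIVATIVE of
`b_k(w)`, whose amplitude carries an extra factor `t ≍ w^{-1/2}`; one more integration by parts
restores uniformity in `w`. This file provides the mechanism:

* `hasDerivAt_V'`, `abs_V''_le`, `abs_V_le`, `hasDerivAt_Y'`, `abs_Y'_le`, `abs_Y''_le` — the
  second derivatives of `V = 1/X'` and of the height `Y = 1/(w(1+t²))`, with the bounds
  `|V| ≤ (9/2)wt²`, `|V''| ≤ 58w` (`t² ≥ 2`), `|Y'| ≤ 2Y/t`, `|Y''| ≤ 6Y/t²`;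
* `branch_integral_parts` — one integration by parts on `[√2, T]` as an IDENTITY for a general
  amplitude `P` vanishing at the endpoints: `∫ e^{iκX} P = -(1/(iκ)) ∫ e^{iκX} (V'P + VP')`;
* `norm_branch_integral_le_two` — two steps: for an amplitude `A` with `‖A‖ ≤ α₀t`, `‖A'‖ ≤ α₁`,
  `t‖A''‖ ≤ α₂` on `[√2, T]`, `T = √(1/(wa))`, and `A, A'` vanishing at the endpoints,
  `‖∫_{√2}^{T} e^{iκX} A‖ ≤ 75(α₀+α₁+α₂)/(κ²a²)` — uniformly in `w` although the amplitude is of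
  size `t ≍ w^{-1/2}` (the twice-differentiated amplitude is `≤ 297w²t³(α₀+α₁+α₂)` and
  `∫₀^T t³ = 1/(4w²a²)`).

## References
* H. Iwaniec, *Spectral Methods of Automorphic Forms*, 2nd ed., AMS GSM 53 (2002), §3.4
  [Iwaniec2002].
* P. Sarnak, *Asymptotic behavior of periodic orbits of the horocycle flow and Eisenstein
  series*, Comm. Pure Appl. Math. 34 (1981), 719–739, Thm. 1 [Sarnak1981].

## Mathlib / tree search
Tree: `HorocyclePhase.hasDerivAt_X`, `hasDerivAt_Y`, `hasDerivAt_V`, `V_mul_X'`, `abs_V'_le`,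
`norm_branch_integral_le` (the one-step template; reused, not modified). Mathlib:
`intervalIntegral.integral_mul_deriv_eq_deriv_mul`, `integral_pow`. No Mathlib non-stationary
phase lemma (`lean search 'stationary'`).
-/

noncomputable section


open Complex MeasureTheory Set Filter Topology intervalIntegral
open scoped Real ContDiff

namespace Literature.NumberTheory.LFunctions

namespace HorocyclePhase

/-! ### More calculus of the parametrisation: `V''` and `Y''` -/

/-- `V'' = 2w(t⁶ - 3t⁴ + 15t² + 3)/(t²-1)³` for `t² ≠ 1`. [folklore] -/
theorem hasDerivAt_V' (w : ℝ) {t : ℝ} (ht : t ^ 2 - 1 ≠ 0) :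
    HasDerivAt (fun t : ℝ => 2 * w * t * (1 + t ^ 2) * (t ^ 2 - 3) / (t ^ 2 - 1) ^ 2)
      (2 * w * ((t ^ 2) ^ 3 - 3 * (t ^ 2) ^ 2 + 15 * t ^ 2 + 3) / (t ^ 2 - 1) ^ 3) t := by
  have h1 : HasDerivAt (fun t : ℝ => 2 * w * t * (1 + t ^ 2) * (t ^ 2 - 3))
      (2 * w * ((1 + t ^ 2) * (t ^ 2 - 3)) + 2 * w * t * (2 * t) * (t ^ 2 - 3) +
        2 * w * t * (1 + t ^ 2) * (2 * t)) t := by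
    have ha : HasDerivAt (fun t : ℝ => 2 * w * t) (2 * w) t := by
      simpa using (hasDerivAt_id t).const_mul (2 * w)
    have hb : HasDerivAt (fun t : ℝ => 1 + t ^ 2) (2 * t) t := by
      simpa using (hasDerivAt_pow 2 t).const_add 1
    have hc : HasDerivAt (fun t : ℝ => t ^ 2 - 3) (2 * t) t := by
      simpa using (hasDerivAt_pow 2 t).sub_const 3
    have := (ha.mul hb).mul hc
    refine this.congr_deriv ?_
    simp only [Pi.mul_apply]
    ring
  have h2 : HasDerivAt (fun t : ℝ => (t ^ 2 - 1) ^ 2) (2 * (t ^ 2 - 1) * (2 * t)) t := by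
    have hc : HasDerivAt (fun t : ℝ => t ^ 2 - 1) (2 * t) t := by
      simpa using (hasDerivAt_pow 2 t).sub_const 1
    have e : (fun t : ℝ => (t ^ 2 - 1) ^ 2) = fun t => (t ^ 2 - 1) * (t ^ 2 - 1) := by
      funext; ring
    rw [e]
    exact (hc.mul hc).congr_deriv (by ring)
  have hne : (t ^ 2 - 1) ^ 2 ≠ 0 := pow_ne_zero 2 ht
  refine ((h1.div h2 hne)).congr_deriv ?_
  field_simp
  ring

/-- `|V''| ≤ 58 w` for `t² ≥ 2` (the maximum is at `t² = 2`; for `s ≥ 2`,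
`29(s-1)³ - (s³-3s²+15s+3) = 4(s-2)(7s²-7s+4) ≥ 0`). [folklore] -/
theorem abs_V''_le {w t : ℝ} (hw : 0 ≤ w) (ht2 : 2 ≤ t ^ 2) :
    |2 * w * ((t ^ 2) ^ 3 - 3 * (t ^ 2) ^ 2 + 15 * t ^ 2 + 3) / (t ^ 2 - 1) ^ 3| ≤ 58 * w := by
  set s := t ^ 2 with hs
  have hs1 : 0 < s - 1 := by linarith
  have hnum : 0 ≤ s ^ 3 - 3 * s ^ 2 + 15 * s + 3 := by nlinarith [sq_nonneg (s - 3), sq_nonneg s]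
  rw [abs_of_nonneg (by positivity), div_le_iff₀ (by positivity)]
  have key : s ^ 3 - 3 * s ^ 2 + 15 * s + 3 ≤ 29 * (s - 1) ^ 3 := by
    nlinarith [mul_nonneg (sub_nonneg.2 ht2) (by nlinarith [sq_nonneg (s - 1/2)] : (0:ℝ) ≤ 7 * s ^ 2 - 7 * s + 4)]
  nlinarith [pow_pos hs1 3]

/-- `|V| ≤ (9/2) w t²` for `t² ≥ 2`. [folklore] -/
theorem abs_V_le {w t : ℝ} (hw : 0 ≤ w) (ht2 : 2 ≤ t ^ 2) :
    |w * (1 + t ^ 2) ^ 2 / (t ^ 2 - 1)| ≤ 9 / 2 * w * t ^ 2 := by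
  have h1 : 0 < t ^ 2 - 1 := by linarith
  rw [abs_of_nonneg (by positivity), div_le_iff₀ h1]
  have key : (1 + t ^ 2) ^ 2 ≤ 9 / 2 * t ^ 2 * (t ^ 2 - 1) := by
    nlinarith [mul_nonneg (sub_nonneg.2 ht2) (by positivity : (0:ℝ) ≤ 7 * t ^ 2 + 1)]
  calc w * (1 + t ^ 2) ^ 2 ≤ w * (9 / 2 * t ^ 2 * (t ^ 2 - 1)) := mul_le_mul_of_nonneg_left key hw
    _ = 9 / 2 * w * t ^ 2 * (t ^ 2 - 1) := by ring

/-- `Y'' = (6t² - 2)/(w(1+t²)³)`. [folklore] -/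
theorem hasDerivAt_Y' {w : ℝ} (hw : w ≠ 0) (t : ℝ) :
    HasDerivAt (fun t : ℝ => -2 * t / (w * (1 + t ^ 2) ^ 2))
      ((6 * t ^ 2 - 2) / (w * (1 + t ^ 2) ^ 3)) t := by
  have h1 : HasDerivAt (fun t : ℝ => -2 * t) (-2) t := by
    simpa using (hasDerivAt_id t).const_mul (-2)
  have h2 : HasDerivAt (fun t : ℝ => w * (1 + t ^ 2) ^ 2) (w * (2 * (1 + t ^ 2) * (2 * t))) t := by
    have := (((hasDerivAt_pow 2 t).const_add 1).pow 2).const_mul w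
    simpa using this
  have ht : (1 + t ^ 2) ≠ 0 := by positivity
  have hne : w * (1 + t ^ 2) ^ 2 ≠ 0 := mul_ne_zero hw (pow_ne_zero 2 ht)
  refine (h1.div h2 hne).congr_deriv ?_
  field_simp
  ring

/-- `|Y'| ≤ 2 Y / t` for `t > 0`. [folklore] -/
theorem abs_Y'_le {w t : ℝ} (hw : 0 < w) (ht : 0 < t) :
    |-2 * t / (w * (1 + t ^ 2) ^ 2)| ≤ 2 * (1 / (w * (1 + t ^ 2))) / t := by
  rw [abs_div, abs_of_pos (by positivity : (0:ℝ) < w * (1 + t ^ 2) ^ 2),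
    show |-2 * t| = 2 * t by rw [abs_mul, abs_neg, abs_two, abs_of_pos ht]]
  rw [div_le_div_iff₀ (by positivity) ht]
  have : 0 < w * (1 + t ^ 2) := by positivity
  rw [show 2 * (1 / (w * (1 + t ^ 2))) * (w * (1 + t ^ 2) ^ 2) = 2 * (1 + t ^ 2) by field_simp]
  nlinarith

/-- `|Y''| ≤ 6 Y / t²` for `t ≠ 0`. [folklore] -/
theorem abs_Y''_le {w t : ℝ} (hw : 0 < w) (ht : t ≠ 0) :
    |(6 * t ^ 2 - 2) / (w * (1 + t ^ 2) ^ 3)| ≤ 6 * (1 / (w * (1 + t ^ 2))) / t ^ 2 := by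
  have ht2 : 0 < t ^ 2 := by positivity
  rw [abs_div, abs_of_pos (by positivity : (0:ℝ) < w * (1 + t ^ 2) ^ 3)]
  rw [div_le_div_iff₀ (by positivity) ht2]
  rw [show 6 * (1 / (w * (1 + t ^ 2))) * (w * (1 + t ^ 2) ^ 3) = 6 * (1 + t ^ 2) ^ 2 by
    field_simp]
  have h6 : |6 * t ^ 2 - 2| ≤ 6 * t ^ 2 + 2 := by
    rw [abs_le]; constructor <;> nlinarith
  nlinarith

/-! ### One integration by parts on a branch, as an identity -/

/-- **Integration by parts against the phase** on the branch `[√2, T]` (`T ≥ √2`, `w ≠ 0`,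
`κ ≠ 0`): for an amplitude `P` with derivative `P₁` on the interval, `P₁` continuous there, and
`P(√2) = P(T) = 0`,
`∫_{√2}^{T} exp(iκX) P = -(1/(iκ)) ∫_{√2}^{T} exp(iκX) (V' P + V P₁)`
(`exp(iκX) = (d/dt) exp(iκX) · V/(iκ)` as `V X' = 1`). [folklore] -/
theorem branch_integral_parts {w κ T : ℝ} {P P₁ : ℝ → ℂ} (hw : w ≠ 0) (hκ : κ ≠ 0)
    (h2T : Real.sqrt 2 ≤ T)
    (hP : ∀ t ∈ Set.uIcc (Real.sqrt 2) T, HasDerivAt P (P₁ t) t)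
    (hP₁c : ContinuousOn P₁ (Set.uIcc (Real.sqrt 2) T))
    (hP2 : P (Real.sqrt 2) = 0) (hPT : P T = 0) :
    ∫ t in Real.sqrt 2..T, Complex.exp (I * κ * (-t / (w * (1 + t ^ 2)) : ℝ)) * P t =
      -(1 / (I * κ)) * ∫ t in Real.sqrt 2..T, Complex.exp (I * κ * (-t / (w * (1 + t ^ 2)) : ℝ)) *
        (((2 * w * t * (1 + t ^ 2) * (t ^ 2 - 3) / (t ^ 2 - 1) ^ 2 : ℝ) : ℂ) * P t +
          ((w * (1 + t ^ 2) ^ 2 / (t ^ 2 - 1) : ℝ) : ℂ) * P₁ t) := by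
  have hs2 : Real.sqrt 2 ^ 2 = 2 := Real.sq_sqrt (by norm_num)
  have hs2pos : 0 < Real.sqrt 2 := Real.sqrt_pos.mpr (by norm_num)
  have hI : ∀ t ∈ Set.uIcc (Real.sqrt 2) T, 0 < t ∧ 2 ≤ t ^ 2 := by
    intro t ht
    rw [Set.uIcc_of_le h2T, Set.mem_Icc] at ht
    refine ⟨lt_of_lt_of_le hs2pos ht.1, ?_⟩
    calc (2:ℝ) = Real.sqrt 2 ^ 2 := hs2.symm
      _ ≤ t ^ 2 := by gcongr; exact ht.1
  -- the players
  set X : ℝ → ℝ := fun t => -t / (w * (1 + t ^ 2)) with hX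
  set X' : ℝ → ℝ := fun t => (t ^ 2 - 1) / (w * (1 + t ^ 2) ^ 2) with hX'
  set V : ℝ → ℝ := fun t => w * (1 + t ^ 2) ^ 2 / (t ^ 2 - 1) with hV
  set V' : ℝ → ℝ := fun t => 2 * w * t * (1 + t ^ 2) * (t ^ 2 - 3) / (t ^ 2 - 1) ^ 2 with hV'
  set v : ℝ → ℂ := fun t => Complex.exp (I * κ * (X t : ℝ)) with hv
  set v' : ℝ → ℂ := fun t => I * κ * (X' t : ℝ) * v t with hv'
  set u : ℝ → ℂ := fun t => P t * (V t : ℝ) / (I * κ) with hu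
  set u' : ℝ → ℂ := fun t => (P₁ t * (V t : ℝ) + P t * (V' t : ℝ)) / (I * κ) with hu'
  have hκC : (κ : ℂ) ≠ 0 := ofReal_ne_zero.mpr hκ
  have hIκ : (I * κ : ℂ) ≠ 0 := mul_ne_zero I_ne_zero hκC
  have hPc : ContinuousOn P (Set.uIcc (Real.sqrt 2) T) := fun t ht =>
    (hP t ht).continuousAt.continuousWithinAt
  -- derivatives
  have hvd : ∀ t, HasDerivAt v (v' t) t := by
    intro t
    have h1 : HasDerivAt (fun t : ℝ => I * κ * (X t : ℝ)) (I * κ * (X' t : ℝ)) t :=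
      ((hasDerivAt_X hw t).ofReal_comp).const_mul (I * κ)
    have := h1.cexp
    simp only [hv, hv']
    convert this using 1
    ring
  have hud : ∀ t ∈ Set.uIcc (Real.sqrt 2) T, HasDerivAt u (u' t) t := by
    intro t ht
    obtain ⟨ht0, ht2⟩ := hI t ht
    have hne : t ^ 2 - 1 ≠ 0 := by linarith
    have h2 : HasDerivAt (fun t => ((V t : ℝ) : ℂ)) ((V' t : ℝ) : ℂ) t :=
      (hasDerivAt_V w hne).ofReal_comp
    exact ((hP t ht).mul h2).div_const (I * κ)
  -- continuity
  have hVc : ContinuousOn (fun t => ((V t : ℝ) : ℂ)) (Set.uIcc (Real.sqrt 2) T) := by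
    intro t ht
    obtain ⟨ht0, ht2⟩ := hI t ht
    have hne : t ^ 2 - 1 ≠ 0 := by linarith
    apply ContinuousAt.continuousWithinAt
    refine continuous_ofReal.continuousAt.comp ?_
    simp only [hV]
    exact ContinuousAt.div (by fun_prop) (by fun_prop) hne
  have hV'c : ContinuousOn (fun t => ((V' t : ℝ) : ℂ)) (Set.uIcc (Real.sqrt 2) T) := by
    intro t ht
    obtain ⟨ht0, ht2⟩ := hI t ht
    have hne : t ^ 2 - 1 ≠ 0 := by linarith
    apply ContinuousAt.continuousWithinAt
    refine continuous_ofReal.continuousAt.comp ?_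
    simp only [hV']
    exact ContinuousAt.div (by fun_prop) (by fun_prop) (by positivity)
  have hu'c : ContinuousOn u' (Set.uIcc (Real.sqrt 2) T) := by
    simp only [hu']
    exact ((hP₁c.mul hVc).add (hPc.mul hV'c)).div_const _
  have hv'c : Continuous v' := by
    simp only [hv', hv, hX, hX']
    refine Continuous.mul (Continuous.mul continuous_const (continuous_ofReal.comp ?_)) ?_
    · exact Continuous.div (by fun_prop) (by fun_prop) fun t => by positivity
    · refine Continuous.cexp (Continuous.mul continuous_const (continuous_ofReal.comp ?_))
      exact Continuous.div (by fun_prop) (by fun_prop) fun t => by positivity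
  -- the integrand is `u v'`
  have hprod : ∀ t ∈ Set.uIcc (Real.sqrt 2) T,
      Complex.exp (I * κ * (-t / (w * (1 + t ^ 2)) : ℝ)) * P t = u t * v' t := by
    intro t ht
    obtain ⟨ht0, ht2⟩ := hI t ht
    have hne : t ^ 2 - 1 ≠ 0 := by linarith
    have key : ((V t : ℝ) : ℂ) * ((X' t : ℝ) : ℂ) = 1 := by
      rw [← ofReal_mul, V_mul_X' hw hne, ofReal_one]
    have e : u t * v' t = P t * v t * (((V t : ℝ) : ℂ) * ((X' t : ℝ) : ℂ)) := by
      simp only [hu, hv']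
      field_simp
    rw [e, key, mul_one]
    simp only [hv, hX]
    ring
  have huT : u T = 0 := by simp only [hu, hPT, zero_mul, zero_div]
  have hu2 : u (Real.sqrt 2) = 0 := by simp only [hu, hP2, zero_mul, zero_div]
  -- integrate by parts
  have hibp := intervalIntegral.integral_mul_deriv_eq_deriv_mul (a := Real.sqrt 2) (b := T)
    (u := u) (v := v) (u' := u') (v' := v') hud (fun t _ => hvd t)
    (hu'c.intervalIntegrable) (hv'c.intervalIntegrable _ _)
  rw [intervalIntegral.integral_congr hprod, hibp, huT, hu2, zero_mul, zero_mul, sub_zero,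
    zero_sub, ← intervalIntegral.integral_neg, ← intervalIntegral.integral_const_mul]
  refine intervalIntegral.integral_congr fun t _ => ?_
  simp only [hu', hv, hX, hV, hV']
  field_simp
  ring


/-! ### Two integrations by parts on a branch -/

/-- **Two-step branch estimate (general amplitude).** Let `0 < a`, `0 < w` with `w a ≤ 1/3`,
`T = √(1/(wa))`, `κ ≠ 0`, and let `A` be an amplitude on `[√2, T]` with `A' = A₁`, `A₁' = A₂`
(`A₂` continuous), `‖A(t)‖ ≤ α₀ t`, `‖A₁(t)‖ ≤ α₁`, `t ‖A₂(t)‖ ≤ α₂`, and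
`A(√2) = A(T) = A₁(√2) = A₁(T) = 0`. Then
`‖∫_{√2}^{T} exp(iκX(t)) A(t) dt‖ ≤ 75 (α₀ + α₁ + α₂) / (κ² a²)`
(two integrations by parts, `branch_integral_parts`; on `t² ≥ 2`: `|V| ≤ (9/2)wt²`, `|V'| ≤ 6wt`,
`|V''| ≤ 58w`, so the twice-differentiated amplitude is `≤ 297 w² t³ (α₀+α₁+α₂)`, and
`∫₀^T t³ = T⁴/4 = 1/(4w²a²)`). [folklore] -/
theorem norm_branch_integral_le_two {a w κ : ℝ} {A A₁ A₂ : ℝ → ℂ} {α₀ α₁ α₂ : ℝ}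
    (ha : 0 < a) (hw : 0 < w) (hwa : w * a ≤ 1 / 3) (hκ : κ ≠ 0)
    (hA : ∀ t ∈ Set.uIcc (Real.sqrt 2) (Real.sqrt (1 / (w * a))), HasDerivAt A (A₁ t) t)
    (hA₁ : ∀ t ∈ Set.uIcc (Real.sqrt 2) (Real.sqrt (1 / (w * a))), HasDerivAt A₁ (A₂ t) t)
    (hA₂c : ContinuousOn A₂ (Set.uIcc (Real.sqrt 2) (Real.sqrt (1 / (w * a)))))
    (h0 : ∀ t ∈ Set.uIcc (Real.sqrt 2) (Real.sqrt (1 / (w * a))), ‖A t‖ ≤ α₀ * t)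
    (h1 : ∀ t ∈ Set.uIcc (Real.sqrt 2) (Real.sqrt (1 / (w * a))), ‖A₁ t‖ ≤ α₁)
    (h2 : ∀ t ∈ Set.uIcc (Real.sqrt 2) (Real.sqrt (1 / (w * a))), t * ‖A₂ t‖ ≤ α₂)
    (hα₀ : 0 ≤ α₀) (hα₁ : 0 ≤ α₁) (hα₂ : 0 ≤ α₂)
    (hA2 : A (Real.sqrt 2) = 0) (hAT : A (Real.sqrt (1 / (w * a))) = 0)
    (hA₁2 : A₁ (Real.sqrt 2) = 0) (hA₁T : A₁ (Real.sqrt (1 / (w * a))) = 0) :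
    ‖∫ t in Real.sqrt 2..Real.sqrt (1 / (w * a)),
        Complex.exp (I * κ * (-t / (w * (1 + t ^ 2)) : ℝ)) * A t‖ ≤
      75 * (α₀ + α₁ + α₂) / (κ ^ 2 * a ^ 2) := by
  set T : ℝ := Real.sqrt (1 / (w * a)) with hT
  have hT2 : T ^ 2 = 1 / (w * a) := Real.sq_sqrt (by positivity)
  have hwa3 : 3 ≤ 1 / (w * a) := by
    rw [le_div_iff₀ (by positivity)]; linarith
  have h2T : Real.sqrt 2 ≤ T := Real.sqrt_le_sqrt (by linarith)
  have hs2 : Real.sqrt 2 ^ 2 = 2 := Real.sq_sqrt (by norm_num)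
  have hs2pos : 0 < Real.sqrt 2 := Real.sqrt_pos.mpr (by norm_num)
  have hI : ∀ t ∈ Set.uIcc (Real.sqrt 2) T, 0 < t ∧ 2 ≤ t ^ 2 := by
    intro t ht
    rw [Set.uIcc_of_le h2T, Set.mem_Icc] at ht
    refine ⟨lt_of_lt_of_le hs2pos ht.1, ?_⟩
    calc (2:ℝ) = Real.sqrt 2 ^ 2 := hs2.symm
      _ ≤ t ^ 2 := by gcongr; exact ht.1
  -- the players
  set V : ℝ → ℝ := fun t => w * (1 + t ^ 2) ^ 2 / (t ^ 2 - 1) with hV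
  set V' : ℝ → ℝ := fun t => 2 * w * t * (1 + t ^ 2) * (t ^ 2 - 3) / (t ^ 2 - 1) ^ 2 with hV'
  set V'' : ℝ → ℝ := fun t => 2 * w * ((t ^ 2) ^ 3 - 3 * (t ^ 2) ^ 2 + 15 * t ^ 2 + 3) /
    (t ^ 2 - 1) ^ 3 with hV''
  set B : ℝ → ℂ := fun t => ((V' t : ℝ) : ℂ) * A t + ((V t : ℝ) : ℂ) * A₁ t with hB
  set B₁ : ℝ → ℂ := fun t => ((V'' t : ℝ) : ℂ) * A t + 2 * ((V' t : ℝ) : ℂ) * A₁ t +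
    ((V t : ℝ) : ℂ) * A₂ t with hB₁
  have hAc : ContinuousOn A (Set.uIcc (Real.sqrt 2) T) := fun t ht =>
    (hA t ht).continuousAt.continuousWithinAt
  have hA₁c : ContinuousOn A₁ (Set.uIcc (Real.sqrt 2) T) := fun t ht =>
    (hA₁ t ht).continuousAt.continuousWithinAt
  -- continuity of `V`, `V'`, `V''` on the interval
  have hVc : ContinuousOn (fun t => ((V t : ℝ) : ℂ)) (Set.uIcc (Real.sqrt 2) T) := by
    intro t ht
    obtain ⟨ht0, ht2⟩ := hI t ht
    have hne : t ^ 2 - 1 ≠ 0 := by linarith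
    apply ContinuousAt.continuousWithinAt
    refine continuous_ofReal.continuousAt.comp ?_
    simp only [hV]
    exact ContinuousAt.div (by fun_prop) (by fun_prop) hne
  have hV'c : ContinuousOn (fun t => ((V' t : ℝ) : ℂ)) (Set.uIcc (Real.sqrt 2) T) := by
    intro t ht
    obtain ⟨ht0, ht2⟩ := hI t ht
    have hne : t ^ 2 - 1 ≠ 0 := by linarith
    apply ContinuousAt.continuousWithinAt
    refine continuous_ofReal.continuousAt.comp ?_
    simp only [hV']
    exact ContinuousAt.div (by fun_prop) (by fun_prop) (pow_ne_zero 2 hne)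
  have hV''c : ContinuousOn (fun t => ((V'' t : ℝ) : ℂ)) (Set.uIcc (Real.sqrt 2) T) := by
    intro t ht
    obtain ⟨ht0, ht2⟩ := hI t ht
    have hne : t ^ 2 - 1 ≠ 0 := by linarith
    apply ContinuousAt.continuousWithinAt
    refine continuous_ofReal.continuousAt.comp ?_
    simp only [hV'']
    exact ContinuousAt.div (by fun_prop) (by fun_prop) (pow_ne_zero 3 hne)
  -- step 1
  have step1 := branch_integral_parts (P := A) (P₁ := A₁) hw.ne' hκ h2T hA hA₁c hA2 hAT
  -- `B` has derivative `B₁` on the interval, vanishes at the endpoints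
  have hBd : ∀ t ∈ Set.uIcc (Real.sqrt 2) T, HasDerivAt B (B₁ t) t := by
    intro t ht
    obtain ⟨ht0, ht2⟩ := hI t ht
    have hne : t ^ 2 - 1 ≠ 0 := by linarith
    have hv : HasDerivAt (fun t => ((V t : ℝ) : ℂ)) ((V' t : ℝ) : ℂ) t :=
      (hasDerivAt_V w hne).ofReal_comp
    have hv' : HasDerivAt (fun t => ((V' t : ℝ) : ℂ)) ((V'' t : ℝ) : ℂ) t :=
      (hasDerivAt_V' w hne).ofReal_comp
    have key := (hv'.mul (hA t ht)).add (hv.mul (hA₁ t ht))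
    have e : ((V'' t : ℝ) : ℂ) * A t + ((V' t : ℝ) : ℂ) * A₁ t +
        (((V' t : ℝ) : ℂ) * A₁ t + ((V t : ℝ) : ℂ) * A₂ t) = B₁ t := by
      simp only [hB₁]; ring
    rw [e] at key
    exact key
  have hB₁c : ContinuousOn B₁ (Set.uIcc (Real.sqrt 2) T) := by
    simp only [hB₁]
    exact ((hV''c.mul hAc).add ((continuousOn_const.mul hV'c).mul hA₁c)).add (hVc.mul hA₂c)
  have hB2 : B (Real.sqrt 2) = 0 := by simp only [hB, hA2, hA₁2, mul_zero, add_zero]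
  have hBT : B T = 0 := by simp only [hB, hAT, hA₁T, mul_zero, add_zero]
  -- step 2
  have step2 := branch_integral_parts (P := B) (P₁ := B₁) hw.ne' hκ h2T hBd hB₁c hB2 hBT
  have hκC : (κ : ℂ) ≠ 0 := ofReal_ne_zero.mpr hκ
  have hIκ : (I * κ : ℂ) ≠ 0 := mul_ne_zero I_ne_zero hκC
  -- combine: `∫ e A = (1/(iκ))² ∫ e (V' B + V B₁)`
  have hcomb : ∫ t in Real.sqrt 2..T, Complex.exp (I * κ * (-t / (w * (1 + t ^ 2)) : ℝ)) * A t =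
      (1 / (I * κ)) ^ 2 * ∫ t in Real.sqrt 2..T, Complex.exp (I * κ * (-t / (w * (1 + t ^ 2)) : ℝ)) *
        (((V' t : ℝ) : ℂ) * B t + ((V t : ℝ) : ℂ) * B₁ t) := by
    rw [step1]
    have e : (fun t : ℝ => Complex.exp (I * κ * (-t / (w * (1 + t ^ 2)) : ℝ)) *
        ((((2 * w * t * (1 + t ^ 2) * (t ^ 2 - 3) / (t ^ 2 - 1) ^ 2 : ℝ) : ℂ)) * A t +
          ((w * (1 + t ^ 2) ^ 2 / (t ^ 2 - 1) : ℝ) : ℂ) * A₁ t)) =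
        fun t : ℝ => Complex.exp (I * κ * (-t / (w * (1 + t ^ 2)) : ℝ)) * B t := by
      funext t; simp only [hB, hV, hV']
    rw [e, step2]
    ring
  rw [hcomb, norm_mul, norm_pow, norm_div, norm_one, norm_mul, Complex.norm_I, one_mul,
    Complex.norm_real, Real.norm_eq_abs]
  -- pointwise bound on the integrand
  have hbound : ∀ t ∈ Set.Ioc (Real.sqrt 2) T,
      ‖Complex.exp (I * κ * (-t / (w * (1 + t ^ 2)) : ℝ)) * (((V' t : ℝ) : ℂ) * B t +
        ((V t : ℝ) : ℂ) * B₁ t)‖ ≤ 297 * w ^ 2 * (α₀ + α₁ + α₂) * t ^ 3 := by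
    intro t ht
    have ht' : t ∈ Set.uIcc (Real.sqrt 2) T := by
      rw [Set.uIcc_of_le h2T]; exact Set.Ioc_subset_Icc_self ht
    obtain ⟨ht0, ht2⟩ := hI t ht'
    have hexp : ‖Complex.exp (I * κ * (-t / (w * (1 + t ^ 2)) : ℝ))‖ = 1 := by
      have e : (I * κ * (-t / (w * (1 + t ^ 2)) : ℝ) : ℂ) =
          ((κ * (-t / (w * (1 + t ^ 2))) : ℝ) : ℂ) * I := by push_cast; ring
      rw [e, Complex.norm_exp_ofReal_mul_I]
    rw [norm_mul, hexp, one_mul]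
    have hVb : |V t| ≤ 9 / 2 * w * t ^ 2 := abs_V_le hw.le ht2
    have hV'b : |V' t| ≤ 6 * w * t := abs_V'_le hw.le ht0.le ht2
    have hV''b : |V'' t| ≤ 58 * w := abs_V''_le hw.le ht2
    have hAb := h0 t ht'
    have hA₁b := h1 t ht'
    have hA₂b := h2 t ht'
    have nV : ‖((V t : ℝ) : ℂ)‖ = |V t| := by rw [Complex.norm_real, Real.norm_eq_abs]
    have nV' : ‖((V' t : ℝ) : ℂ)‖ = |V' t| := by rw [Complex.norm_real, Real.norm_eq_abs]
    have nV'' : ‖((V'' t : ℝ) : ℂ)‖ = |V'' t| := by rw [Complex.norm_real, Real.norm_eq_abs]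
    -- `‖B‖ ≤ |V'| ‖A‖ + |V| ‖A₁‖`, `‖B₁‖ ≤ |V''| ‖A‖ + 2|V'| ‖A₁‖ + |V| ‖A₂‖`
    have hBn : ‖B t‖ ≤ |V' t| * (α₀ * t) + |V t| * α₁ := by
      simp only [hB]
      refine (norm_add_le _ _).trans (add_le_add ?_ ?_)
      · rw [norm_mul, nV']; exact mul_le_mul_of_nonneg_left hAb (abs_nonneg _)
      · rw [norm_mul, nV]; exact mul_le_mul_of_nonneg_left hA₁b (abs_nonneg _)
    have hVA₂ : |V t| * ‖A₂ t‖ ≤ 9 / 2 * w * t * α₂ := by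
      calc |V t| * ‖A₂ t‖ ≤ (9 / 2 * w * t ^ 2) * ‖A₂ t‖ :=
            mul_le_mul_of_nonneg_right hVb (norm_nonneg _)
        _ = 9 / 2 * w * t * (t * ‖A₂ t‖) := by ring
        _ ≤ 9 / 2 * w * t * α₂ := mul_le_mul_of_nonneg_left hA₂b (by positivity)
    have hB₁n : ‖B₁ t‖ ≤ (58 * w) * (α₀ * t) + 2 * (6 * w * t) * α₁ + 9 / 2 * w * t * α₂ := by
      simp only [hB₁]
      refine (norm_add_le _ _).trans (add_le_add ((norm_add_le _ _).trans (add_le_add ?_ ?_)) ?_)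
      · rw [norm_mul, nV'']
        exact mul_le_mul hV''b hAb (norm_nonneg _) (by positivity)
      · rw [norm_mul, norm_mul, nV', Complex.norm_two]
        exact mul_le_mul (mul_le_mul_of_nonneg_left hV'b zero_le_two) hA₁b (norm_nonneg _)
          (by positivity)
      · rw [norm_mul, nV]
        exact hVA₂
    have hBn' : ‖B t‖ ≤ (6 * w * t) * (α₀ * t) + (9 / 2 * w * t ^ 2) * α₁ :=
      hBn.trans (add_le_add (mul_le_mul_of_nonneg_right hV'b (by positivity))
        (mul_le_mul_of_nonneg_right hVb hα₁))
    calc ‖((V' t : ℝ) : ℂ) * B t + ((V t : ℝ) : ℂ) * B₁ t‖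
        ≤ |V' t| * ‖B t‖ + |V t| * ‖B₁ t‖ := by
          refine (norm_add_le _ _).trans (add_le_add ?_ ?_)
          · rw [norm_mul, nV']
          · rw [norm_mul, nV]
      _ ≤ (6 * w * t) * ((6 * w * t) * (α₀ * t) + (9 / 2 * w * t ^ 2) * α₁) +
          (9 / 2 * w * t ^ 2) * ((58 * w) * (α₀ * t) + 2 * (6 * w * t) * α₁ +
            9 / 2 * w * t * α₂) :=
          add_le_add (mul_le_mul hV'b hBn' (norm_nonneg _) (by positivity))
            (mul_le_mul hVb hB₁n (norm_nonneg _) (by positivity))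
      _ = w ^ 2 * t ^ 3 * (297 * α₀ + 81 * α₁ + 81 / 4 * α₂) := by ring
      _ ≤ 297 * w ^ 2 * (α₀ + α₁ + α₂) * t ^ 3 := by
          have : 0 ≤ w ^ 2 * t ^ 3 := by positivity
          nlinarith
  have hle := intervalIntegral.norm_integral_le_of_norm_le h2T (ae_of_all volume hbound)
    ((by fun_prop : Continuous fun t : ℝ => 297 * w ^ 2 * (α₀ + α₁ + α₂) * t ^ 3).intervalIntegrable
      _ _)
  have hint : ∫ t in Real.sqrt 2..T, 297 * w ^ 2 * (α₀ + α₁ + α₂) * t ^ 3 ≤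
      75 * (α₀ + α₁ + α₂) / a ^ 2 := by
    have hI3 : ∫ t in Real.sqrt 2..T, t ^ 3 = (T ^ 4 - Real.sqrt 2 ^ 4) / 4 := by
      rw [integral_pow]; norm_num
    have hT4 : T ^ 4 = (1 / (w * a)) ^ 2 := by
      rw [show 4 = 2 * 2 by norm_num, pow_mul, hT2]
    have hs4 : Real.sqrt 2 ^ 4 = 4 := by
      rw [show 4 = 2 * 2 by norm_num, pow_mul, hs2]; norm_num
    rw [intervalIntegral.integral_const_mul, hI3, hT4, hs4]
    have hαs : 0 ≤ α₀ + α₁ + α₂ := by positivity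
    have hw0 : w ≠ 0 := hw.ne'
    have ha0 : a ≠ 0 := ha.ne'
    have e : 297 * w ^ 2 * (α₀ + α₁ + α₂) * (((1 / (w * a)) ^ 2 - 4) / 4) =
        297 / 4 * (α₀ + α₁ + α₂) / a ^ 2 - 297 * w ^ 2 * (α₀ + α₁ + α₂) := by
      rw [div_pow, one_pow, mul_pow]
      field_simp
    rw [e]
    have h1 : 0 ≤ 297 * w ^ 2 * (α₀ + α₁ + α₂) := by positivity
    have h2 : 297 / 4 * (α₀ + α₁ + α₂) / a ^ 2 ≤ 75 * (α₀ + α₁ + α₂) / a ^ 2 := by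
      apply div_le_div_of_nonneg_right _ (by positivity)
      nlinarith
    linarith
  calc (1 / |κ|) ^ 2 * ‖∫ t in Real.sqrt 2..T, Complex.exp (I * κ * (-t / (w * (1 + t ^ 2)) : ℝ)) *
        (((V' t : ℝ) : ℂ) * B t + ((V t : ℝ) : ℂ) * B₁ t)‖
      ≤ (1 / |κ|) ^ 2 * (75 * (α₀ + α₁ + α₂) / a ^ 2) :=
        mul_le_mul_of_nonneg_left (hle.trans hint) (by positivity)
    _ = 75 * (α₀ + α₁ + α₂) / (κ ^ 2 * a ^ 2) := by
        rw [div_pow, one_pow, sq_abs]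
        field_simp

end HorocyclePhase

end Literature.NumberTheory.LFunctions

end
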